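import Literature.NumberTheory.DiophantineGeometry.SimplestQuarticThueRoots
import Literature.NumberTheory.DiophantineGeometry.SimplestQuarticThueProofs

/-!
# The simplest quartic Thue equations: no solutions with `2 ≤ |y| ≤ (t − 1)/5` [ChenVoutier1997, §3.2]

Proved companion of the named fact `SimplestQuarticThueSolutions` ([ChenVoutier1997, Thm 3]).
[ChenVoutier1997, §3.2] first dispose of the "small" solutions: "(3.1) has no solutions with
`1 < |y| < 0.193t` for `t ≥ 128`" (via the continued fractions of the four roots `β⁽ʲ⁾`, after "if
`|y| > 1` then `x/y` is a convergent").  Here we prove the corresponding statement **for every `t ≥ 5`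
and `2 ≤ |y| ≤ (t − 1)/5`** (`no_solution_of_two_le_abs`), by the same mechanism made direct: for a
solution, `δ⁽⁰⁾δ⁽¹⁾δ⁽²⁾δ⁽³⁾ = 1` ((3.17), `prod_abs_sub_root_mul_eq_one`), the smallest `δ⁽ʲ⁾ = |x − β⁽ʲ⁾y|`
is `≤ 1`, the others are `≥ |β⁽ⁱ⁾ − β⁽ʲ⁾||y| − 1` ((3.18)), whence an upper bound
`δ⁽ʲ⁾ ≤ 1/∏_{i ≠ j}(2|β⁽ⁱ⁾ − β⁽ʲ⁾| − 1)`; and a lower bound for `δ⁽ʲ⁾` from the location of `β⁽ʲ⁾y`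
strictly between consecutive integers (`β⁽²⁾y ∈ ty + (0, 1)`, `β⁽¹⁾y ∈ y − (0, 2/5)`,
`β⁽³⁾y ∈ −y − (0, 2/5)`, `β⁽⁰⁾y ∈ (−1/5, 0) ∖ {0}`), using the root bounds of
`SimplestQuarticThueRoots`.  By the order-four symmetry the same holds with `|x|` in place of `|y|`,
so (`simplestQuarticThueSolutions_of_large`) the fact is reduced to the solutions with
`|x|, |y| > (t − 1)/5` (and `≥ 2`) — the "large" solutions that [ChenVoutier1997] treat with the
irrationality measure of Thm 5 (`t ≥ 128`) and [LettlPetho1995] with linear forms in logarithms.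

## References

* Chen Jian Hua, P. M. Voutier, J. Number Theory 62 (1997) 71–99 = arXiv:1401.5450, §3.2.
  [ChenVoutier1997]
-/

noncomputable section

namespace Literature.NumberTheory.DiophantineGeometry

namespace SimplestQuarticThue

open Real

/-! ## Generic pieces of the `δ`-argument -/

/-- (3.18): `δ⁽ⁱ⁾ ≥ |β⁽ⁱ⁾ − β⁽ʲ⁾||y| − δ⁽ʲ⁾`. [cite: ChenVoutier1997, §3.2 (3.18)] -/
theorem abs_sub_mul_ge (x y βi βj : ℝ) : |βi - βj| * |y| - |x - βj * y| ≤ |x - βi * y| := by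
  have e : (βi - βj) * y = (x - βj * y) - (x - βi * y) := by ring
  have h := abs_sub (x - βj * y) (x - βi * y)
  rw [← e, abs_mul] at h
  linarith

/-- The smallest of four nonnegative reals with product `1` is `≤ 1`. [folklore] -/
theorem le_one_of_prod_eq_one {a b c d : ℝ} (h : a * b * c * d = 1) (ha : 0 ≤ a) (hab : a ≤ b)
    (hac : a ≤ c) (had : a ≤ d) : a ≤ 1 := by
  by_contra h1
  push Not at h1
  have hb : 1 < b := by linarith
  have hc : 1 < c := by linarith
  have hd : 1 < d := by linarith
  have h2 : 1 < a * b := by nlinarith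
  have h3 : 1 < a * b * c := by nlinarith
  have h4 : 1 < a * b * c * d := by nlinarith
  linarith

/-- From `abcd = 1` and positive lower bounds for `b, c, d`: `a ≤ 1/(L_b L_c L_d)`. [folklore] -/
theorem le_one_div_of_prod_eq_one {a b c d Lb Lc Ld : ℝ} (h : a * b * c * d = 1) (ha : 0 ≤ a)
    (hLb : 0 < Lb) (hLc : 0 < Lc) (hLd : 0 < Ld) (hb : Lb ≤ b) (hc : Lc ≤ c) (hd : Ld ≤ d) :
    a ≤ 1 / (Lb * Lc * Ld) := by
  rw [le_div_iff₀ (by positivity)]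
  have h1 : Lb * Lc ≤ b * c := mul_le_mul hb hc hLc.le (hLb.le.trans hb)
  have h2 : Lb * Lc * Ld ≤ b * c * d :=
    mul_le_mul h1 hd hLd.le (mul_nonneg (hLb.le.trans hb) (hLc.le.trans hc))
  calc a * (Lb * Lc * Ld) ≤ a * (b * c * d) := mul_le_mul_of_nonneg_left h2 ha
    _ = 1 := by rw [← h]; ring

/-- An integer is at distance `≥ min(f, 1 − f)` from `m + f` (`m ∈ ℤ`, `0 ≤ f ≤ 1`). [folklore] -/
theorem min_le_abs_int_sub_add {x m : ℤ} {f : ℝ} (hf0 : 0 ≤ f) (hf1 : f ≤ 1) :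
    min f (1 - f) ≤ |(x : ℝ) - ((m : ℝ) + f)| := by
  rcases le_or_gt x m with h | h
  · have h' : (x : ℝ) ≤ m := by exact_mod_cast h
    rw [abs_sub_comm, abs_of_nonneg (by linarith)]
    exact le_trans (min_le_left _ _) (by linarith)
  · have h' : (m : ℝ) + 1 ≤ x := by
      have := Int.add_one_le_iff.2 h
      exact_mod_cast this
    rw [abs_of_nonneg (by linarith)]
    exact le_trans (min_le_right _ _) (by linarith)

/-- An integer is at distance `≥ min(f, 1 − f)` from `m − f` (`m ∈ ℤ`, `0 ≤ f ≤ 1`). [folklore] -/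
theorem min_le_abs_int_sub_sub {x m : ℤ} {f : ℝ} (hf0 : 0 ≤ f) (hf1 : f ≤ 1) :
    min f (1 - f) ≤ |(x : ℝ) - ((m : ℝ) - f)| := by
  have h := min_le_abs_int_sub_add (x := -x) (m := -m) hf0 hf1
  rwa [show ((-x : ℤ) : ℝ) - (((-m : ℤ) : ℝ) + f) = -((x : ℝ) - ((m : ℝ) - f)) by push_cast; ring,
    abs_neg] at h

/-! ## Two more root bounds -/

variable {T ε ρ : ℝ}

/-- `1/ε ∈ (2T/(T² + 4), 2/T)` for `T > 0`. [cite: ChenVoutier1997, §3.2] -/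
theorem inv_eps_bounds (hε : 0 < ε) (h : ε - ε⁻¹ = T / 2) (hT : 0 < T) :
    2 * T / (T ^ 2 + 4) < ε⁻¹ ∧ ε⁻¹ < 2 / T := by
  obtain ⟨h1, h2⟩ := eps_bounds hε h hT
  constructor
  · have h3 : ε < (T ^ 2 + 4) / (2 * T) := by
      rw [show (T ^ 2 + 4) / (2 * T) = T / 2 + 2 / T by field_simp; ring]; exact h2
    have := one_div_lt_one_div_of_lt hε h3
    rw [one_div_div, one_div] at this
    exact this
  · have := one_div_lt_one_div_of_lt (by positivity) h1
    rw [one_div_div, one_div] at this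
    simpa using this

/-- `β⁽²⁾ = ε + ρ > T + 4T/(T² + 4)` (refining `β⁽²⁾ > T`). [cite: ChenVoutier1997, §3.2] -/
theorem root_two_gt (hε : 0 < ε) (h : ε - ε⁻¹ = T / 2) (hT : 0 < T) (hρ : 0 < ρ)
    (hρ2 : ρ ^ 2 = 1 + ε ^ 2) : T + 4 * T / (T ^ 2 + 4) < ε + ρ := by
  obtain ⟨hi1, -⟩ := inv_eps_bounds hε h hT
  have hρε : ε < ρ := (rho_bounds hε hρ hρ2).1
  have e : 4 * T / (T ^ 2 + 4) = 2 * (2 * T / (T ^ 2 + 4)) := by ring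
  linarith

/-- `β⁽¹⁾ = (ρ − 1)/ε < 1 − 2(T − 1)/(T² + 4)` for `T ≥ 2` (refining `β⁽¹⁾ < 1`).
[cite: ChenVoutier1997, §3.2] -/
theorem root_one_lt (hε : 0 < ε) (h : ε - ε⁻¹ = T / 2) (hT : 2 ≤ T) (hρ : 0 < ρ)
    (hρ2 : ρ ^ 2 = 1 + ε ^ 2) : (ρ - 1) / ε < 1 - 2 * (T - 1) / (T ^ 2 + 4) := by
  have hT0 : 0 < T := by linarith
  obtain ⟨hi1, hi2⟩ := inv_eps_bounds hε h hT0
  obtain ⟨-, hr2⟩ := rho_bounds hε hρ hρ2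
  set u := ε⁻¹ with hu
  set a := 2 * T / (T ^ 2 + 4) with ha
  have hu0 : 0 < u := inv_pos.2 hε
  have ha0 : 0 ≤ a := by rw [ha]; positivity
  -- `β⁽¹⁾ = (ρ − 1)u < (ε + u/2 − 1)u = 1 − u + u²/2`
  have h1 : (ρ - 1) / ε < 1 - u + u ^ 2 / 2 := by
    rw [div_eq_mul_inv, ← hu]
    have h3 : (ρ - 1) * u < (ε + 1 / (2 * ε) - 1) * u := mul_lt_mul_of_pos_right (by linarith) hu0
    have e : (ε + 1 / (2 * ε) - 1) * u = 1 - u + u ^ 2 / 2 := by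
      rw [hu]; field_simp; ring
    linarith
  -- `u − u²/2 ≥ a − a²/2 ≥ 2(T − 1)/(T² + 4)`
  have h2 : a - a ^ 2 / 2 ≤ u - u ^ 2 / 2 := by
    have hsum : u + a < 2 := by
      have : 2 / T ≤ 1 := by rw [div_le_one hT0]; linarith
      linarith
    nlinarith [mul_nonneg (by linarith : 0 ≤ u - a) (by linarith : 0 ≤ 1 - (u + a) / 2)]
  have h3 : 2 * (T - 1) / (T ^ 2 + 4) ≤ a - a ^ 2 / 2 := by
    have e1 : 2 * (T - 1) / (T ^ 2 + 4) = a - a ^ 2 / 2 - 4 * a / (T * (T ^ 2 + 4)) := by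
      rw [ha]; field_simp; ring
    have hpos : 0 ≤ 4 * a / (T * (T ^ 2 + 4)) := by positivity
    linarith
  linarith

/-! ## The four cases of the `δ`-argument (which `δ⁽ʲ⁾` is smallest), as real-variable lemmas -/

/-- Among four reals one is `≤` the three others. [folklore] -/
theorem min4_cases (a b c d : ℝ) :
    (a ≤ b ∧ a ≤ c ∧ a ≤ d) ∨ (b ≤ a ∧ b ≤ c ∧ b ≤ d) ∨ (c ≤ a ∧ c ≤ b ∧ c ≤ d) ∨
      (d ≤ a ∧ d ≤ b ∧ d ≤ c) := by
  rcases le_total a b with h1 | h1 <;> rcases le_total c d with h2 | h2 <;>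
    rcases le_total a c with h3 | h3 <;> rcases le_total a d with h4 | h4 <;>
    rcases le_total b c with h5 | h5 <;> rcases le_total b d with h6 | h6
  all_goals first
    | exact Or.inl ⟨by linarith, by linarith, by linarith⟩
    | exact Or.inr (Or.inl ⟨by linarith, by linarith, by linarith⟩)
    | exact Or.inr (Or.inr (Or.inl ⟨by linarith, by linarith, by linarith⟩))
    | exact Or.inr (Or.inr (Or.inr ⟨by linarith, by linarith, by linarith⟩))

/-- Case `δ⁽⁰⁾` smallest (`x/y` near `β⁽⁰⁾ ∈ (−1/t, −1/(t+1))`): `δ⁽⁰⁾ ≥ 2/(t+1)` (according as `x = 0`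
or not) against `δ⁽⁰⁾ ≤ 15/(8(2t − 1))`. [cite: ChenVoutier1997, §3.2] -/
theorem case_zero {t x y : ℤ} {β0 β1 β2 β3 : ℝ} (ht : (5 : ℝ) ≤ t) (hy2 : (2 : ℝ) ≤ y)
    (hy5 : 5 * (y : ℝ) ≤ t - 1) (h0lo : -(1 / (t : ℝ)) < β0) (h0hi : β0 < -(1 / ((t : ℝ) + 1)))
    (h1lo : 1 - 2 / (t : ℝ) < β1) (h2lo : (t : ℝ) < β2)
    (h3hi : β3 < -1 - 2 * t / ((t : ℝ) ^ 2 + 4))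
    (hprod : |(x : ℝ) - β0 * y| * |(x : ℝ) - β1 * y| * |(x : ℝ) - β2 * y| * |(x : ℝ) - β3 * y| = 1)
    (hmin : |(x : ℝ) - β0 * y| ≤ |(x : ℝ) - β1 * y| ∧ |(x : ℝ) - β0 * y| ≤ |(x : ℝ) - β2 * y| ∧
      |(x : ℝ) - β0 * y| ≤ |(x : ℝ) - β3 * y|) : False := by
  have hT0 : (0 : ℝ) < t := by linarith
  have hi1 : (0 : ℝ) < 1 / ((t : ℝ) + 1) := by positivity
  have ei1 : 2 / ((t : ℝ) + 1) = 2 * (1 / ((t : ℝ) + 1)) := by ring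
  obtain ⟨h01, h02, h03⟩ := hmin
  set δ0 := |(x : ℝ) - β0 * y| with hδ0
  set δ1 := |(x : ℝ) - β1 * y| with hδ1
  set δ2 := |(x : ℝ) - β2 * y| with hδ2
  set δ3 := |(x : ℝ) - β3 * y| with hδ3
  have hle1 : δ0 ≤ 1 := le_one_of_prod_eq_one hprod (abs_nonneg _) h01 h02 h03
  have hYabs : |(y : ℝ)| = y := abs_of_nonneg (by linarith)
  have hA : 1 / (t : ℝ) ≤ 2 * t / ((t : ℝ) ^ 2 + 4) := by
    rw [div_le_div_iff₀ hT0 (by positivity)]; nlinarith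
  -- separations
  have hs01 : (23 : ℝ) / 30 ≤ β1 - β0 := by
    have h1 : (23 : ℝ) / 30 ≤ 1 - 2 / (t : ℝ) + 1 / ((t : ℝ) + 1) := by
      rw [show 1 - 2 / (t : ℝ) + 1 / ((t : ℝ) + 1) = ((t : ℝ) ^ 2 - 2) / (t * (t + 1)) by
        field_simp; ring]
      rw [div_le_div_iff₀ (by norm_num) (by positivity)]
      nlinarith [mul_nonneg (by linarith : (0 : ℝ) ≤ (t : ℝ) - 5)
        (by positivity : (0 : ℝ) ≤ 7 * (t : ℝ) + 12)]
    linarith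
  have hs02 : (t : ℝ) ≤ β2 - β0 := by linarith
  have hs03 : (1 : ℝ) ≤ β0 - β3 := by linarith
  -- `(3.18)`
  have hL1 : (8 : ℝ) / 15 ≤ δ1 := by
    have h1 := abs_sub_mul_ge (x : ℝ) (y : ℝ) β1 β0
    rw [hYabs, abs_of_nonneg (by linarith : (0 : ℝ) ≤ β1 - β0)] at h1
    have h2 : (23 : ℝ) / 30 * 2 ≤ (β1 - β0) * y := mul_le_mul hs01 hy2 (by norm_num) (by linarith)
    linarith
  have hL2 : 2 * (t : ℝ) - 1 ≤ δ2 := by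
    have h1 := abs_sub_mul_ge (x : ℝ) (y : ℝ) β2 β0
    rw [hYabs, abs_of_nonneg (by linarith : (0 : ℝ) ≤ β2 - β0)] at h1
    have h2 : (t : ℝ) * 2 ≤ (β2 - β0) * y := mul_le_mul hs02 hy2 (by norm_num) (by linarith)
    linarith
  have hL3 : (1 : ℝ) ≤ δ3 := by
    have h1 := abs_sub_mul_ge (x : ℝ) (y : ℝ) β3 β0
    rw [hYabs, abs_sub_comm, abs_of_nonneg (by linarith : (0 : ℝ) ≤ β0 - β3)] at h1
    have h2 : (1 : ℝ) * 2 ≤ (β0 - β3) * y := mul_le_mul hs03 hy2 (by norm_num) (by linarith)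
    linarith
  have hup : δ0 ≤ 1 / (8 / 15 * (2 * (t : ℝ) - 1) * 1) :=
    le_one_div_of_prod_eq_one hprod (abs_nonneg _) (by norm_num) (by linarith) (by norm_num)
      hL1 hL2 hL3
  -- lower bound
  have hlow : 2 / ((t : ℝ) + 1) ≤ δ0 := by
    rcases eq_or_ne x 0 with hx | hx
    · have e : δ0 = -β0 * y := by
        rw [hδ0, hx]; push_cast
        rw [zero_sub, abs_neg, abs_mul, hYabs, abs_of_neg (by linarith)]
      rw [e]
      have : 1 / ((t : ℝ) + 1) * 2 ≤ -β0 * y := mul_le_mul (by linarith) hy2 (by norm_num) (by linarith)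
      linarith
    · have hx1 : (1 : ℝ) ≤ |(x : ℝ)| := by exact_mod_cast Int.one_le_abs hx
      have htri : |(x : ℝ)| - |β0 * (y : ℝ)| ≤ δ0 := abs_sub_abs_le_abs_sub _ _
      have hb : |β0 * (y : ℝ)| ≤ 1 / 5 := by
        rw [abs_mul, hYabs, abs_of_neg (by linarith)]
        have h1 : -β0 * (y : ℝ) ≤ 1 / (t : ℝ) * y :=
          mul_le_mul_of_nonneg_right (by linarith) (by linarith)
        have h2 : 1 / (t : ℝ) * y ≤ 1 / 5 := by
          rw [div_mul_eq_mul_div, div_le_div_iff₀ hT0 (by norm_num)]; linarith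
        linarith
      have h3 : 2 / ((t : ℝ) + 1) ≤ 1 / 3 := by
        rw [div_le_div_iff₀ (by positivity) (by norm_num)]; linarith
      linarith
  have key := hlow.trans hup
  rw [div_le_div_iff₀ (by positivity) (by nlinarith)] at key
  nlinarith

/-- Case `δ⁽¹⁾` smallest (`x/y` near `β⁽¹⁾ ∈ (1 − 2/t, 1 − 2(t−1)/(t²+4))`): `β⁽¹⁾y = (y − 1) + (1 − g)`
with `g ∈ [4(t−1)/(t²+4), 2/5]`, so `δ⁽¹⁾ ≥ 4(t−1)/(t²+4)`, against `δ⁽¹⁾ ≤ 25/(11(2t − 3))`.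
[cite: ChenVoutier1997, §3.2] -/
theorem case_one {t x y : ℤ} {β0 β1 β2 β3 : ℝ} (ht : (5 : ℝ) ≤ t) (hy2 : (2 : ℝ) ≤ y)
    (hy5 : 5 * (y : ℝ) ≤ t - 1) (h0hi : β0 < 0) (h1lo : 1 - 2 / (t : ℝ) < β1)
    (h1hi : β1 < 1 - 2 * ((t : ℝ) - 1) / ((t : ℝ) ^ 2 + 4)) (h2lo : (t : ℝ) < β2) (h3hi : β3 < -1)
    (hprod : |(x : ℝ) - β0 * y| * |(x : ℝ) - β1 * y| * |(x : ℝ) - β2 * y| * |(x : ℝ) - β3 * y| = 1)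
    (hmin : |(x : ℝ) - β1 * y| ≤ |(x : ℝ) - β0 * y| ∧ |(x : ℝ) - β1 * y| ≤ |(x : ℝ) - β2 * y| ∧
      |(x : ℝ) - β1 * y| ≤ |(x : ℝ) - β3 * y|) : False := by
  have hT0 : (0 : ℝ) < t := by linarith
  obtain ⟨h10, h12, h13⟩ := hmin
  set δ0 := |(x : ℝ) - β0 * y| with hδ0
  set δ1 := |(x : ℝ) - β1 * y| with hδ1
  set δ2 := |(x : ℝ) - β2 * y| with hδ2
  set δ3 := |(x : ℝ) - β3 * y| with hδ3
  have hle1 : δ1 ≤ 1 :=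
    le_one_of_prod_eq_one (by rw [← hprod]; ring) (abs_nonneg _) h10 h12 h13
  have hYabs : |(y : ℝ)| = y := abs_of_nonneg (by linarith)
  have h2t : 2 / (t : ℝ) ≤ 2 / 5 := div_le_div_of_nonneg_left (by norm_num) (by norm_num) ht
  have hGpos : (0 : ℝ) ≤ 2 * ((t : ℝ) - 1) / ((t : ℝ) ^ 2 + 4) :=
    div_nonneg (by linarith) (by positivity)
  -- `(3.18)`
  have hL0 : (1 : ℝ) / 5 ≤ δ0 := by
    have h1 := abs_sub_mul_ge (x : ℝ) (y : ℝ) β0 β1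
    rw [hYabs, abs_sub_comm, abs_of_nonneg (by linarith : (0 : ℝ) ≤ β1 - β0)] at h1
    have h2 : (1 - 2 / (t : ℝ)) * 2 ≤ (β1 - β0) * y :=
      mul_le_mul (by linarith) hy2 (by norm_num) (by linarith)
    linarith
  have hL2 : 2 * (t : ℝ) - 3 ≤ δ2 := by
    have h1 := abs_sub_mul_ge (x : ℝ) (y : ℝ) β2 β1
    rw [hYabs, abs_of_nonneg (by linarith : (0 : ℝ) ≤ β2 - β1)] at h1
    have h2 : ((t : ℝ) - 1) * 2 ≤ (β2 - β1) * y :=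
      mul_le_mul (by linarith) hy2 (by norm_num) (by linarith)
    linarith
  have hL3 : (11 : ℝ) / 5 ≤ δ3 := by
    have h1 := abs_sub_mul_ge (x : ℝ) (y : ℝ) β3 β1
    rw [hYabs, abs_sub_comm, abs_of_nonneg (by linarith : (0 : ℝ) ≤ β1 - β3)] at h1
    have h2 : (2 - 2 / (t : ℝ)) * 2 ≤ (β1 - β3) * y :=
      mul_le_mul (by linarith) hy2 (by norm_num) (by linarith)
    linarith
  have hup : δ1 ≤ 1 / (1 / 5 * (2 * (t : ℝ) - 3) * (11 / 5)) :=
    le_one_div_of_prod_eq_one (by rw [← hprod]; ring) (abs_nonneg _) (by norm_num) (by linarith)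
      (by norm_num) hL0 hL2 hL3
  -- lower bound
  set g : ℝ := (1 - β1) * y with hg
  have hG : 4 * ((t : ℝ) - 1) / ((t : ℝ) ^ 2 + 4) ≤ g := by
    have h1 : 2 * ((t : ℝ) - 1) / ((t : ℝ) ^ 2 + 4) * 2 ≤ (1 - β1) * y :=
      mul_le_mul (by linarith) hy2 (by norm_num) (by linarith)
    have e : 4 * ((t : ℝ) - 1) / ((t : ℝ) ^ 2 + 4) = 2 * ((t : ℝ) - 1) / ((t : ℝ) ^ 2 + 4) * 2 := by
      ring
    linarith
  have hg25 : g ≤ 2 / 5 := by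
    have h1 : g ≤ 2 / (t : ℝ) * y :=
      mul_le_mul_of_nonneg_right (by linarith) (by linarith)
    have h2 : 2 / (t : ℝ) * y ≤ 2 / 5 := by
      rw [div_mul_eq_mul_div, div_le_div_iff₀ hT0 (by norm_num)]; linarith
    linarith
  have hG35 : 4 * ((t : ℝ) - 1) / ((t : ℝ) ^ 2 + 4) ≤ 3 / 5 := by
    rw [div_le_div_iff₀ (by positivity) (by norm_num)]
    nlinarith [mul_nonneg (by linarith : (0 : ℝ) ≤ (t : ℝ) - 4) (by linarith : (0 : ℝ) ≤ 3 * (t : ℝ) - 8)]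
  have hG0 : (0 : ℝ) ≤ 4 * ((t : ℝ) - 1) / ((t : ℝ) ^ 2 + 4) :=
    div_nonneg (by linarith) (by positivity)
  have hlow : 4 * ((t : ℝ) - 1) / ((t : ℝ) ^ 2 + 4) ≤ δ1 := by
    have hf := min_le_abs_int_sub_add (x := x) (m := y - 1) (f := 1 - g) (by linarith) (by linarith)
    have e : (((y - 1 : ℤ)) : ℝ) + (1 - g) = β1 * y := by push_cast; rw [hg]; ring
    rw [e, sub_sub_cancel] at hf
    exact (le_min (by linarith) hG).trans hf
  have key := hlow.trans hup
  rw [div_le_div_iff₀ (by positivity) (by nlinarith)] at key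
  nlinarith [mul_nonneg (by linarith : (0 : ℝ) ≤ (t : ℝ) - 5) (by linarith : (0 : ℝ) ≤ (t : ℝ) - 5)]

/-- Case `δ⁽²⁾` smallest (`x/y` near `β⁽²⁾ ∈ (t + 4t/(t²+4), t + 5/t)`): `β⁽²⁾y = ty + f` with
`f ∈ [1/t, 1 − 1/t]`, so `δ⁽²⁾ ≥ 1/t`, against `δ⁽²⁾ ≤ 1/((2t−1)(2t−3)(2t+1))`.
[cite: ChenVoutier1997, §3.2] -/
theorem case_two {t x y : ℤ} {β0 β1 β2 β3 : ℝ} (ht : (5 : ℝ) ≤ t) (hy2 : (2 : ℝ) ≤ y)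
    (hy5 : 5 * (y : ℝ) ≤ t - 1) (h0hi : β0 < 0) (h1hi : β1 < 1)
    (h2lo : (t : ℝ) + 4 * t / ((t : ℝ) ^ 2 + 4) < β2) (h2hi : β2 < t + 5 / (t : ℝ)) (h3hi : β3 < -1)
    (hprod : |(x : ℝ) - β0 * y| * |(x : ℝ) - β1 * y| * |(x : ℝ) - β2 * y| * |(x : ℝ) - β3 * y| = 1)
    (hmin : |(x : ℝ) - β2 * y| ≤ |(x : ℝ) - β0 * y| ∧ |(x : ℝ) - β2 * y| ≤ |(x : ℝ) - β1 * y| ∧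
      |(x : ℝ) - β2 * y| ≤ |(x : ℝ) - β3 * y|) : False := by
  have hT0 : (0 : ℝ) < t := by linarith
  have hApos : (0 : ℝ) < 4 * t / ((t : ℝ) ^ 2 + 4) := by positivity
  have h2lo' : (t : ℝ) < β2 := by linarith
  obtain ⟨h20, h21, h23⟩ := hmin
  set δ0 := |(x : ℝ) - β0 * y| with hδ0
  set δ1 := |(x : ℝ) - β1 * y| with hδ1
  set δ2 := |(x : ℝ) - β2 * y| with hδ2
  set δ3 := |(x : ℝ) - β3 * y| with hδ3
  have hle1 : δ2 ≤ 1 :=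
    le_one_of_prod_eq_one (by rw [← hprod]; ring) (abs_nonneg _) h20 h21 h23
  have hYabs : |(y : ℝ)| = y := abs_of_nonneg (by linarith)
  -- `(3.18)`
  have hL0 : 2 * (t : ℝ) - 1 ≤ δ0 := by
    have h1 := abs_sub_mul_ge (x : ℝ) (y : ℝ) β0 β2
    rw [hYabs, abs_sub_comm, abs_of_nonneg (by linarith : (0 : ℝ) ≤ β2 - β0)] at h1
    have h2 : (t : ℝ) * 2 ≤ (β2 - β0) * y := mul_le_mul (by linarith) hy2 (by norm_num) (by linarith)
    linarith
  have hL1 : 2 * (t : ℝ) - 3 ≤ δ1 := by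
    have h1 := abs_sub_mul_ge (x : ℝ) (y : ℝ) β1 β2
    rw [hYabs, abs_sub_comm, abs_of_nonneg (by linarith : (0 : ℝ) ≤ β2 - β1)] at h1
    have h2 : ((t : ℝ) - 1) * 2 ≤ (β2 - β1) * y :=
      mul_le_mul (by linarith) hy2 (by norm_num) (by linarith)
    linarith
  have hL3 : 2 * (t : ℝ) + 1 ≤ δ3 := by
    have h1 := abs_sub_mul_ge (x : ℝ) (y : ℝ) β3 β2
    rw [hYabs, abs_sub_comm, abs_of_nonneg (by linarith : (0 : ℝ) ≤ β2 - β3)] at h1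
    have h2 : ((t : ℝ) + 1) * 2 ≤ (β2 - β3) * y :=
      mul_le_mul (by linarith) hy2 (by norm_num) (by linarith)
    linarith
  have hup : δ2 ≤ 1 / ((2 * (t : ℝ) - 1) * (2 * (t : ℝ) - 3) * (2 * (t : ℝ) + 1)) :=
    le_one_div_of_prod_eq_one (by rw [← hprod]; ring) (abs_nonneg _) (by linarith) (by linarith)
      (by linarith) hL0 hL1 hL3
  -- lower bound
  set f : ℝ := (β2 - t) * y with hf_def
  have hf0 : 1 / (t : ℝ) ≤ f := by
    have h1 : 4 * t / ((t : ℝ) ^ 2 + 4) * 2 ≤ (β2 - t) * y :=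
      mul_le_mul (by linarith) hy2 (by norm_num) (by linarith)
    have h2 : 1 / (t : ℝ) ≤ 4 * t / ((t : ℝ) ^ 2 + 4) * 2 := by
      rw [div_mul_eq_mul_div, div_le_div_iff₀ hT0 (by positivity)]; nlinarith
    linarith
  have hf1 : f ≤ 1 - 1 / (t : ℝ) := by
    have h1 : f ≤ 5 / (t : ℝ) * y :=
      mul_le_mul_of_nonneg_right (by linarith) (by linarith)
    have h2 : 5 / (t : ℝ) * y ≤ 1 - 1 / t := by
      rw [show 1 - 1 / (t : ℝ) = ((t : ℝ) - 1) / t by field_simp, div_mul_eq_mul_div,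
        div_le_div_iff₀ hT0 hT0]
      nlinarith
    linarith
  have hlow : 1 / (t : ℝ) ≤ δ2 := by
    have h1t : (0 : ℝ) < 1 / t := by positivity
    have hf := min_le_abs_int_sub_add (x := x) (m := t * y) (f := f) (by linarith) (by linarith)
    have e : (((t * y : ℤ)) : ℝ) + f = β2 * y := by push_cast; rw [hf_def]; ring
    rw [e] at hf
    exact (le_min hf0 (by linarith)).trans hf
  have key := hlow.trans hup
  have hp : (0 : ℝ) < (2 * (t : ℝ) - 1) * (2 * (t : ℝ) - 3) * (2 * (t : ℝ) + 1) := by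
    have : (0 : ℝ) < 2 * (t : ℝ) - 1 := by linarith
    have : (0 : ℝ) < 2 * (t : ℝ) - 3 := by linarith
    positivity
  rw [div_le_div_iff₀ hT0 hp] at key
  have hs : (0 : ℝ) ≤ (t : ℝ) - 5 := by linarith
  nlinarith [mul_nonneg (mul_nonneg hs hs) hs, mul_nonneg hs hs]

/-- Case `δ⁽³⁾` smallest (`x/y` near `β⁽³⁾ ∈ (−1 − 2/t − 2/t², −1 − 2t/(t²+4))`):
`β⁽³⁾y = (−y − 1) + (1 − g)` with `g ∈ [2t/(t²+4), 2/5]`, so `δ⁽³⁾ ≥ 2t/(t²+4)`, against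
`δ⁽³⁾ ≤ 5/(11(2t + 1))`. [cite: ChenVoutier1997, §3.2] -/
theorem case_three {t x y : ℤ} {β0 β1 β2 β3 : ℝ} (ht : (5 : ℝ) ≤ t) (hy2 : (2 : ℝ) ≤ y)
    (hy5 : 5 * (y : ℝ) ≤ t - 1) (h0lo : -(1 / (t : ℝ)) < β0) (h1lo : 1 - 2 / (t : ℝ) < β1)
    (h2lo : (t : ℝ) < β2) (h3lo : -1 - 2 / (t : ℝ) - 2 / (t : ℝ) ^ 2 < β3)
    (h3hi : β3 < -1 - 2 * t / ((t : ℝ) ^ 2 + 4))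
    (hprod : |(x : ℝ) - β0 * y| * |(x : ℝ) - β1 * y| * |(x : ℝ) - β2 * y| * |(x : ℝ) - β3 * y| = 1)
    (hmin : |(x : ℝ) - β3 * y| ≤ |(x : ℝ) - β0 * y| ∧ |(x : ℝ) - β3 * y| ≤ |(x : ℝ) - β1 * y| ∧
      |(x : ℝ) - β3 * y| ≤ |(x : ℝ) - β2 * y|) : False := by
  have hT0 : (0 : ℝ) < t := by linarith
  obtain ⟨h30, h31, h32⟩ := hmin
  set δ0 := |(x : ℝ) - β0 * y| with hδ0
  set δ1 := |(x : ℝ) - β1 * y| with hδ1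
  set δ2 := |(x : ℝ) - β2 * y| with hδ2
  set δ3 := |(x : ℝ) - β3 * y| with hδ3
  have hle1 : δ3 ≤ 1 :=
    le_one_of_prod_eq_one (by rw [← hprod]; ring) (abs_nonneg _) h30 h31 h32
  have hYabs : |(y : ℝ)| = y := abs_of_nonneg (by linarith)
  have hA : 1 / (t : ℝ) ≤ 2 * t / ((t : ℝ) ^ 2 + 4) := by
    rw [div_le_div_iff₀ hT0 (by positivity)]; nlinarith
  have hA0 : (0 : ℝ) ≤ 2 * t / ((t : ℝ) ^ 2 + 4) := by positivity
  have h2t : 2 / (t : ℝ) ≤ 2 / 5 := div_le_div_of_nonneg_left (by norm_num) (by norm_num) ht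
  -- `(3.18)`
  have hL0 : (1 : ℝ) ≤ δ0 := by
    have h1 := abs_sub_mul_ge (x : ℝ) (y : ℝ) β0 β3
    rw [hYabs, abs_of_nonneg (by linarith : (0 : ℝ) ≤ β0 - β3)] at h1
    have h2 : (1 : ℝ) * 2 ≤ (β0 - β3) * y := mul_le_mul (by linarith) hy2 (by norm_num) (by linarith)
    linarith
  have hL1 : (11 : ℝ) / 5 ≤ δ1 := by
    have h1 := abs_sub_mul_ge (x : ℝ) (y : ℝ) β1 β3
    rw [hYabs, abs_of_nonneg (by linarith : (0 : ℝ) ≤ β1 - β3)] at h1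
    have h2 : (2 - 2 / (t : ℝ)) * 2 ≤ (β1 - β3) * y :=
      mul_le_mul (by linarith) hy2 (by norm_num) (by linarith)
    linarith
  have hL2 : 2 * (t : ℝ) + 1 ≤ δ2 := by
    have h1 := abs_sub_mul_ge (x : ℝ) (y : ℝ) β2 β3
    rw [hYabs, abs_of_nonneg (by linarith : (0 : ℝ) ≤ β2 - β3)] at h1
    have h2 : ((t : ℝ) + 1) * 2 ≤ (β2 - β3) * y :=
      mul_le_mul (by linarith) hy2 (by norm_num) (by linarith)
    linarith
  have hup : δ3 ≤ 1 / (1 * (11 / 5) * (2 * (t : ℝ) + 1)) :=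
    le_one_div_of_prod_eq_one (by rw [← hprod]; ring) (abs_nonneg _) (by norm_num) (by norm_num)
      (by linarith) hL0 hL1 hL2
  -- lower bound
  set g : ℝ := (-1 - β3) * y with hg
  have hG : 2 * (t : ℝ) / ((t : ℝ) ^ 2 + 4) ≤ g := by
    have h1 : 2 * (t : ℝ) / ((t : ℝ) ^ 2 + 4) * 2 ≤ (-1 - β3) * y :=
      mul_le_mul (by linarith) hy2 (by norm_num) (by linarith)
    linarith
  have hg25 : g ≤ 2 / 5 := by
    have h1 : g ≤ (2 / (t : ℝ) + 2 / (t : ℝ) ^ 2) * y :=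
      mul_le_mul_of_nonneg_right (by linarith) (by linarith)
    have e : 2 / (t : ℝ) + 2 / (t : ℝ) ^ 2 = (2 * t + 2) / (t : ℝ) ^ 2 := by
      rw [div_add_div _ _ hT0.ne' (pow_ne_zero 2 hT0.ne'),
        div_eq_div_iff (mul_ne_zero hT0.ne' (pow_ne_zero 2 hT0.ne')) (pow_ne_zero 2 hT0.ne')]
      ring
    have h2 : (2 / (t : ℝ) + 2 / (t : ℝ) ^ 2) * y ≤ 2 / 5 := by
      rw [e, div_mul_eq_mul_div, div_le_div_iff₀ (by positivity) (by norm_num)]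
      nlinarith [mul_le_mul_of_nonneg_left hy5 (by linarith : (0 : ℝ) ≤ 2 * (t : ℝ) + 2)]
    linarith
  have hG35 : 2 * (t : ℝ) / ((t : ℝ) ^ 2 + 4) ≤ 3 / 5 := by
    rw [div_le_div_iff₀ (by positivity) (by norm_num)]; nlinarith [sq_nonneg ((t : ℝ) - 2)]
  have hlow : 2 * (t : ℝ) / ((t : ℝ) ^ 2 + 4) ≤ δ3 := by
    have hf := min_le_abs_int_sub_add (x := x) (m := -y - 1) (f := 1 - g) (by linarith)
      (by linarith)
    have e : (((-y - 1 : ℤ)) : ℝ) + (1 - g) = β3 * y := by push_cast; rw [hg]; ring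
    rw [e, sub_sub_cancel] at hf
    exact (le_min (by linarith) hG).trans hf
  have key := hlow.trans hup
  rw [div_le_div_iff₀ (by positivity) (by positivity)] at key
  nlinarith

/-! ## No solutions with `2 ≤ |y| ≤ (t − 1)/5`, and the reduction of the fact to large solutions -/

/-- **No "small" solutions** [ChenVoutier1997, §3.2]: for `t ≥ 5` the equation `P_t(x, y) = ±1` has
no integer solution with `2 ≤ y` and `5y ≤ t − 1`. (Printed: none with `1 < |y| < 0.193t`, `t ≥ 128`,
by continued fractions.) [cite: ChenVoutier1997, §3.2] -/
theorem no_solution_of_two_le {t x y : ℤ} (ht : 5 ≤ t) (hy2 : 2 ≤ y) (hy5 : 5 * y ≤ t - 1)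
    (hP : simplestQuarticForm t x y = 1 ∨ simplestQuarticForm t x y = -1) : False := by
  obtain ⟨ε, hε, h⟩ := exists_eps (t : ℝ)
  obtain ⟨ρ, hρ, hρ2⟩ := exists_rho ε
  have hT : (5 : ℝ) ≤ (t : ℝ) := by exact_mod_cast ht
  have hT0 : (0 : ℝ) < t := by linarith
  have hY2 : (2 : ℝ) ≤ (y : ℝ) := by exact_mod_cast hy2
  have hY5 : 5 * (y : ℝ) ≤ (t : ℝ) - 1 := by exact_mod_cast hy5
  obtain ⟨h2lo, h2hi⟩ := root_two_bounds hε h hT0 hρ hρ2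
  have h2lo' := root_two_gt hε h hT0 hρ hρ2
  obtain ⟨h0lo, h0hi⟩ := root_zero_bounds hε h hT0 hρ hρ2
  obtain ⟨h1lo, h1hi⟩ := root_one_bounds hε h (by linarith) hρ hρ2
  have h1hi' := root_one_lt hε h (by linarith) hρ hρ2
  obtain ⟨h3lo, h3hi⟩ := root_three_bounds hε h (by linarith) hρ hρ2
  have h0hi' : ε - ρ < -(1 / ((t : ℝ) + 1)) := by
    refine lt_of_lt_of_le h0hi (neg_le_neg ?_)
    apply one_div_le_one_div_of_le (by positivity)
    have : 5 / (t : ℝ) ≤ 1 := by rw [div_le_one hT0]; linarith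
    linarith
  have h3hi' : -(ρ + 1) / ε < -1 := by
    have : (0 : ℝ) < 2 * t / ((t : ℝ) ^ 2 + 4) := by positivity
    linarith
  have h0neg : ε - ρ < 0 := by
    have : (0 : ℝ) < 1 / ((t : ℝ) + 1) := by positivity
    linarith
  have hprod := prod_abs_sub_root_mul_eq_one hε h hρ2 hP
  rcases min4_cases |(x : ℝ) - (ε - ρ) * y| |(x : ℝ) - (ρ - 1) / ε * y| |(x : ℝ) - (ε + ρ) * y|
      |(x : ℝ) - -(ρ + 1) / ε * y| with hm | hm | hm | hm
  · exact case_zero hT hY2 hY5 h0lo h0hi' h1lo h2lo h3hi hprod hm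
  · exact case_one hT hY2 hY5 h0neg h1lo h1hi' h2lo h3hi' hprod hm
  · exact case_two hT hY2 hY5 h0neg h1hi h2lo' h2hi h3hi' hprod hm
  · exact case_three hT hY2 hY5 h0lo h1lo h2lo h3lo h3hi hprod hm

/-- The same for `|y|`: no solutions with `2 ≤ |y|`, `5|y| ≤ t − 1` (`P_t(−x, −y) = P_t(x, y)`).
[cite: ChenVoutier1997, §3.2] -/
theorem no_solution_of_two_le_abs {t x y : ℤ} (ht : 5 ≤ t) (hy2 : 2 ≤ |y|) (hy5 : 5 * |y| ≤ t - 1)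
    (hP : simplestQuarticForm t x y = 1 ∨ simplestQuarticForm t x y = -1) : False := by
  rcases le_or_gt 0 y with h0 | h0
  · rw [abs_of_nonneg h0] at hy2 hy5
    exact no_solution_of_two_le ht hy2 hy5 hP
  · rw [abs_of_neg h0] at hy2 hy5
    refine no_solution_of_two_le (x := -x) (y := -y) ht hy2 hy5 ?_
    rwa [simplestQuarticForm_neg_neg]

/-- And for `|x|`, by the order-four symmetry `P_t(y, −x) = P_t(x, y)`: no solutions with `2 ≤ |x|`,
`5|x| ≤ t − 1`. [cite: ChenVoutier1997, §3.2] -/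
theorem no_solution_of_two_le_abs_x {t x y : ℤ} (ht : 5 ≤ t) (hx2 : 2 ≤ |x|) (hx5 : 5 * |x| ≤ t - 1)
    (hP : simplestQuarticForm t x y = 1 ∨ simplestQuarticForm t x y = -1) : False := by
  refine no_solution_of_two_le_abs (x := y) (y := -x) ht (by rwa [abs_neg]) (by rwa [abs_neg]) ?_
  rwa [simplestQuarticForm_rotate]

/-- **Reduction of `SimplestQuarticThueSolutions` to the large solutions.**  With
`simplestQuarticThueSolutions_of_two_le_abs` (solutions with `min(|x|, |y|) ≤ 1`) and
`no_solution_of_two_le_abs(_x)` (none with `2 ≤ |x| ≤ (t−1)/5` or `2 ≤ |y| ≤ (t−1)/5`, `t ≥ 5`), the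
fact follows from: every solution with `|x|, |y| ≥ 2` and, when `t ≥ 5`, `5|x|, 5|y| > t − 1`, is one
of `±(2, 3), ±(3, −2)` at `t = 4` — the statement [ChenVoutier1997] derive from Thm 5 for `t ≥ 128`
and [LettlPetho1995] prove for `t ≤ 127`. [cite: ChenVoutier1997, §3.2] -/
theorem simplestQuarticThueSolutions_of_large
    (hlarge : ∀ t : ℤ, 1 ≤ t → t ≠ 3 → ∀ x y : ℤ, 2 ≤ |x| → 2 ≤ |y| →
      (5 ≤ t → t - 1 < 5 * |x| ∧ t - 1 < 5 * |y|) →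
      (simplestQuarticForm t x y = 1 ∨ simplestQuarticForm t x y = -1) →
        t = 4 ∧ (x, y) ∈ ({(-3, 2), (-2, -3), (2, 3), (3, -2)} : Set (ℤ × ℤ))) :
    SimplestQuarticThueSolutions := by
  refine simplestQuarticThueSolutions_of_two_le_abs fun t ht ht3 x y hx hy hP => ?_
  refine hlarge t ht ht3 x y hx hy (fun ht5 => ⟨?_, ?_⟩) hP
  · by_contra hc
    exact no_solution_of_two_le_abs_x ht5 hx (by omega) hP
  · by_contra hc
    exact no_solution_of_two_le_abs ht5 hy (by omega) hP

end SimplestQuarticThue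

end Literature.NumberTheory.DiophantineGeometry
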